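import Summits.Parity.GeneralizedHardyLittlewood.Theorems.BeyondDiagonalBeatsQuarter.OffDiagHeartApprox
import Summits.Parity.GeneralizedHardyLittlewood.Theorems.BeyondDiagonalBeatsQuarter.OffDiagTailsMollifiedBoxes
import Summits.Parity.GeneralizedHardyLittlewood.Theorems.BeyondDiagonalBeatsQuarter.OffDiagDualAssembly
import HarnessLib

/-!
# Route `PrimeLevelFamEdge`, crux K_B (stmt-Parity-20343), line `diagonal_kernel_split` rev 4, plan Ω,
# sub-line **Ω-h (v3) — the heart reduced to a block bound for the NEAR HEAD: finitely many Petersson moduli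
# `r ≤ q⁷`, finitely many dyadic boxes (`2^{i₁+i₂}d₁d₂ < 4q̂²(log q)⁴`), each box on the DUAL side**

Composition of Ω-h v1 (`offDiagBelowSlack_io_of_approxBlockAtCleanScales`, p638144: any `ε·ms`-approximant) with
prover-3's W-b (ii) `PeterssonSplit.offDiagMollified_add_near_le` (the `r`-tail beyond `q⁷` AND the far dyadic boxes are
`≤ ε·mainScaleReal`, eventually in prime `q`, uniformly in `0 < Δ′ ≤ 2`) and Ω-d5 (`OffDiag.tsum_box_eq_tsum_dual`: each near
box IS its dual series):

* `offDiagNearHead Δ′ q` (definition, reviewed): `−re(2q̂(2π/q)·Σ_{r<q⁷} Σ_{l,m≤q̂^{Δ′}} c_l c_m·Σ_{d₁∣l,d₂∣m}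
  Σ_{i ∈ nearBoxes q d₁ d₂ (log q)⁴} Σ_k θ(k₁/2^{i₁})θ(k₂/2^{i₂})·w_q(d₁k₁,d₂k₂)·petKloostermanTerm q ((l/d₁)k₁)((m/d₂)k₂) (r+1))`
  — a FINITE sum of finite box sums (`OffDiag.tsum_dyadicBox_eq_sum`), total in `q`;
* `abs_offDiagMollified_sub_offDiagNearHead_le` — `|offDiagMollified − offDiagNearHead| ≤ ε·ms` eventually (W-b);
* **`offDiagBelowSlack_io_of_nearHeadBlockAtCleanScales(_a₀)`** — a block bound for the near head at clean scales, in
  p634449's quantifier shells, gives `stub_offDiagBelowSlack_io` VERBATIM;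
* **`offDiagNearHead_eq_dual`** — for `q` prime: the near head equals the same finite sum with every box replaced by its dual
  series `Σ_{h∈ℤ²} Φ̂_{q,d₁,d₂,l/d₁,m/d₂,r+1,i}(h₁/(q(r+1)), h₂/(q(r+1)))·N_{q(r+1)}(l/d₁, m/d₂; h₁, h₂)` — the object that L2c
  (dual truncation with costs), L3 (trivial ledger), L6′ (principal/deviation split: `OffDiagDivisorSwitch`, `OffDiagLevelAP`,
  `OffDiagDualCompletion*`) and L7/L8 now work on.

Bookkeeping over landed theorems; standard axioms. Helper; closes nothing (the block bound is LIVE-Ω).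
«The programme SEARCHES and TYPES; no claim about Landau–Siegel zeros, Theorems 1–2 of arXiv:2211.02515 or
a repaired Margin232 until a kernel theorem says so.»
-/

noncomputable section

open Finset Polynomial
open scoped Real FourierTransform

namespace Summit.Parity.GeneralizedHardyLittlewood.Theorems.BeyondDiagonalBeatsQuarter.OffDiag

open Literature.NumberTheory.LFunctions Literature.NumberTheory.LFunctions.KMV2000
open Literature.NumberTheory.LFunctions.KowalskiMichel2000 (petKloostermanTerm)
open Literature.Analysis.Calculus.WhitneyConvex (dyadicBump)
open Literature.NumberTheory.Sieve.FriedlanderIwaniecPrimes (fourier2)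
open PeterssonSplit (afeWeight offDiag offDiagMollified nearBoxes offDiagMollified_add_near_le)

/-! ### The near head -/

/-- **The near head of the mollified off-diagonal** (Petersson moduli `q(r+1)`, `r < q⁷`; near dyadic boxes
`i ∈ nearBoxes q d₁ d₂ (log q)⁴`; primal box sums). `0` at `q = 0`.
[cite: KowalskiMichelVanderKam2000, §6 p. 19, (21)–(23) p. 12; KowalskiMichel2000, §2.4.2 p. 312 — derivation] -/
def offDiagNearHead (Δ' : ℝ) (q : ℕ) : ℝ :=
  if hq : q = 0 then 0 else
    (haveI : NeZero q := ⟨hq⟩;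
      -(2 * (qhat q : ℂ) * (2 * π / q) *
          ∑ r ∈ Finset.range (q ^ 7), ∑ l ∈ Icc 1 ⌊qhat q ^ Δ'⌋₊, ∑ m ∈ Icc 1 ⌊qhat q ^ Δ'⌋₊,
            ((mollifierCoeff (X ^ 2) (qhat q ^ Δ') l * mollifierCoeff (X ^ 2) (qhat q ^ Δ') m : ℝ) : ℂ) *
              ∑ d₁ ∈ l.divisors, ∑ d₂ ∈ m.divisors, ∑ i ∈ nearBoxes q d₁ d₂ (Real.log q ^ 4),
                ∑' k : ℕ × ℕ, ((dyadicBump ((k.1 : ℝ) / 2 ^ i.1) * dyadicBump ((k.2 : ℝ) / 2 ^ i.2) : ℝ) : ℂ) *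
                  ((afeWeight q (d₁ * k.1, d₂ * k.2) : ℂ) *
                    petKloostermanTerm q (l / d₁ * k.1) (m / d₂ * k.2) (r + 1))).re)

/-- Re-indexing `Σ_{r ∈ Icc 1 R} f r = Σ_{r < R} f (r+1)`. [folklore] -/
theorem sum_Icc_one_eq_sum_range_succ {M : Type*} [AddCommMonoid M] (f : ℕ → M) (R : ℕ) :
    ∑ r ∈ Icc 1 R, f r = ∑ r ∈ Finset.range R, f (r + 1) := by
  rw [← Finset.Ico_add_one_right_eq_Icc, Finset.sum_Ico_eq_sum_range]
  refine Finset.sum_congr (by simp) fun r _ ↦ ?_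
  rw [add_comm]

/-- Unfolding the near head at a non-zero level, in W-b's `Icc 1 (q⁷)` indexing.
[cite: KowalskiMichelVanderKam2000, §6 p. 19 — derivation] -/
theorem offDiagNearHead_eq (Δ' : ℝ) (q : ℕ) [NeZero q] :
    offDiagNearHead Δ' q =
      -(2 * (qhat q : ℂ) * (2 * π / q) *
          ∑ r ∈ Icc 1 (q ^ 7), ∑ l ∈ Icc 1 ⌊qhat q ^ Δ'⌋₊, ∑ m ∈ Icc 1 ⌊qhat q ^ Δ'⌋₊,
            ((mollifierCoeff (X ^ 2) (qhat q ^ Δ') l * mollifierCoeff (X ^ 2) (qhat q ^ Δ') m : ℝ) : ℂ) *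
              ∑ d₁ ∈ l.divisors, ∑ d₂ ∈ m.divisors, ∑ i ∈ nearBoxes q d₁ d₂ (Real.log q ^ 4),
                ∑' k : ℕ × ℕ, ((dyadicBump ((k.1 : ℝ) / 2 ^ i.1) * dyadicBump ((k.2 : ℝ) / 2 ^ i.2) : ℝ) : ℂ) *
                  ((afeWeight q (d₁ * k.1, d₂ * k.2) : ℂ) *
                    petKloostermanTerm q (l / d₁ * k.1) (m / d₂ * k.2) r)).re := by
  unfold offDiagNearHead
  rw [dif_neg (NeZero.ne q), sum_Icc_one_eq_sum_range_succ]

/-- **The near head approximates the mollified off-diagonal to every precision `ε·ms`, eventually**: for every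
`ε > 0` there is `q₀` with `|offDiagMollified Δ′ q − offDiagNearHead Δ′ q| ≤ ε·mainScaleReal Δ′ q` for all primes `q ≥ q₀`
and all `0 < Δ′ ≤ 2` (W-b: `r`-tail beyond `q⁷` and far boxes).
[cite: KowalskiMichel2000, §2.4.2 p. 312 (23); KowalskiMichelVanderKam2000, (22) p. 12, §6 p. 19 — derivation] -/
theorem abs_offDiagMollified_sub_offDiagNearHead_le {ε : ℝ} (hε : 0 < ε) :
    ∃ q₀ : ℕ, ∀ q : ℕ, q₀ ≤ q → q.Prime → ∀ Δ' : ℝ, 0 < Δ' → Δ' ≤ 2 →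
      |offDiagMollified Δ' q - offDiagNearHead Δ' q| ≤ ε * mainScaleReal Δ' q := by
  obtain ⟨q₀, hq₀⟩ := offDiagMollified_add_near_le hε
  refine ⟨q₀, fun q hq0 hq Δ' hΔ0 hΔ2 ↦ ?_⟩
  haveI : NeZero q := ⟨hq.ne_zero⟩
  have h := hq₀ q hq hq0 Δ' hΔ0 hΔ2 (q ^ 7) (by push_cast; exact le_rfl)
  rw [offDiagNearHead_eq, sub_neg_eq_add]
  exact h

/-- **Ω-h (v3): the heart from a block bound for the NEAR HEAD at clean scales** (`c′₀`-first shell).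
[cite: MontgomeryVaughan2007, Cor. 11.10 (Page); KowalskiMichelVanderKam2000, §6 p. 19 — derivation] -/
theorem offDiagBelowSlack_io_of_nearHeadBlockAtCleanScales
    (hΩ : ∀ c₀' : ℝ, 0 < c₀' → ∃ b : ℝ, 1 < b ∧ ∀ Δ' : ℝ, 1 < Δ' → Δ' < b →
      ∃ U : ℝ, U < 4 * (Δ' - 1) / Δ' ∧ ∃ a₀ : ℝ, 0 < a₀ ∧ ∃ η' : ℝ, 0 < η' ∧ η' < c₀' / a₀ ∧
        ∃ N₀ : ℕ, ∀ N : ℕ, N₀ ≤ N → CleanScale a₀ η' N →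
          ∑ q ∈ goodPrimes Δ' N, offDiagNearHead Δ' q ≤ U * ∑ q ∈ goodPrimes Δ' N, mainScaleReal Δ' q) :
    ∃ b : ℝ, 1 < b ∧ ∀ Δ' : ℝ, 1 < Δ' → Δ' < b → ∃ U : ℝ, U < 4 * (Δ' - 1) / Δ' ∧
      ∀ q₀ : ℕ, ∃ q : ℕ, ∃ _ : NeZero q, q₀ ≤ q ∧ q.Prime ∧
        (∀ n : ℕ, (n : ℝ) ≠ qhat q ^ Δ') ∧
          -(∑ l ∈ Icc 1 ⌊qhat q ^ Δ'⌋₊, ∑ m ∈ Icc 1 ⌊qhat q ^ Δ'⌋₊,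
              ((mollifierCoeff (X ^ 2) (qhat q ^ Δ') l * mollifierCoeff (X ^ 2) (qhat q ^ Δ') m : ℝ) : ℂ) *
                offDiag q l m).re ≤ U * mainScaleReal Δ' q :=
  offDiagBelowSlack_io_of_approxBlockAtCleanScales offDiagNearHead
    (fun Δ' h1 h2 ε hε ↦ by
      obtain ⟨q₀, hq₀⟩ := abs_offDiagMollified_sub_offDiagNearHead_le hε
      exact ⟨q₀, fun q hq0 hq ↦ hq₀ q hq0 hq Δ' (lt_trans zero_lt_one h1) h2.le⟩)
    hΩ

/-- The same in the `a₀`-first shell. [cite: MontgomeryVaughan2007, Cor. 11.10 (Page); KowalskiMichelVanderKam2000, §6 p. 19 — derivation] -/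
theorem offDiagBelowSlack_io_of_nearHeadBlockAtCleanScales_a₀
    (hΩ : ∃ a₀ : ℝ, 0 < a₀ ∧ ∀ η₀ : ℝ, 0 < η₀ → ∃ b : ℝ, 1 < b ∧ ∀ Δ' : ℝ, 1 < Δ' → Δ' < b →
      ∃ U : ℝ, U < 4 * (Δ' - 1) / Δ' ∧ ∃ η' : ℝ, 0 < η' ∧ η' < η₀ ∧ ∃ N₀ : ℕ, ∀ N : ℕ, N₀ ≤ N →
        CleanScale a₀ η' N →
          ∑ q ∈ goodPrimes Δ' N, offDiagNearHead Δ' q ≤ U * ∑ q ∈ goodPrimes Δ' N, mainScaleReal Δ' q) :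
    ∃ b : ℝ, 1 < b ∧ ∀ Δ' : ℝ, 1 < Δ' → Δ' < b → ∃ U : ℝ, U < 4 * (Δ' - 1) / Δ' ∧
      ∀ q₀ : ℕ, ∃ q : ℕ, ∃ _ : NeZero q, q₀ ≤ q ∧ q.Prime ∧
        (∀ n : ℕ, (n : ℝ) ≠ qhat q ^ Δ') ∧
          -(∑ l ∈ Icc 1 ⌊qhat q ^ Δ'⌋₊, ∑ m ∈ Icc 1 ⌊qhat q ^ Δ'⌋₊,
              ((mollifierCoeff (X ^ 2) (qhat q ^ Δ') l * mollifierCoeff (X ^ 2) (qhat q ^ Δ') m : ℝ) : ℂ) *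
                offDiag q l m).re ≤ U * mainScaleReal Δ' q :=
  offDiagBelowSlack_io_of_approxBlockAtCleanScales_a₀ offDiagNearHead
    (fun Δ' h1 h2 ε hε ↦ by
      obtain ⟨q₀, hq₀⟩ := abs_offDiagMollified_sub_offDiagNearHead_le hε
      exact ⟨q₀, fun q hq0 hq ↦ hq₀ q hq0 hq Δ' (lt_trans zero_lt_one h1) h2.le⟩)
    hΩ

/-! ### The near head on the dual side -/

/-- Congruence helper: `S = S′ ⇒ −re(p·S) = −re(p·S′)` (avoids definitional unfolding of large sums). [folklore] -/
theorem neg_re_mul_congr {p S S' : ℂ} (h : S = S') : -(p * S).re = -(p * S').re := by rw [h]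

/-- **The near head on the dual side.** For `q ≥ 1` (no primality needed), every near box is its dual series (Ω-d5):
`offDiagNearHead Δ′ q = −re(2q̂(2π/q)·Σ_{r<q⁷} Σ_{l,m} c_l c_m·Σ_{d₁∣l,d₂∣m} Σ_{i ∈ nearBoxes} Σ_{h∈ℤ²}
Φ̂_{q,d₁,d₂,l/d₁,m/d₂,r+1,i}(h₁/(q(r+1)), h₂/(q(r+1)))·N_{q(r+1)}(l/d₁, m/d₂; h₁, h₂))`.
[cite: KowalskiMichelVanderKam2000, (21)–(23) p. 12 and Lemma 3.3 p. 9 — derivation] -/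
theorem offDiagNearHead_eq_dual {q : ℕ} [NeZero q] (Δ' : ℝ) :
    offDiagNearHead Δ' q =
      -(2 * (qhat q : ℂ) * (2 * π / q) *
          ∑ r ∈ Finset.range (q ^ 7), ∑ l ∈ Icc 1 ⌊qhat q ^ Δ'⌋₊, ∑ m ∈ Icc 1 ⌊qhat q ^ Δ'⌋₊,
            ((mollifierCoeff (X ^ 2) (qhat q ^ Δ') l * mollifierCoeff (X ^ 2) (qhat q ^ Δ') m : ℝ) : ℂ) *
              ∑ d₁ ∈ l.divisors, ∑ d₂ ∈ m.divisors, ∑ i ∈ nearBoxes q d₁ d₂ (Real.log q ^ 4),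
                ∑' h : ℤ × ℤ,
                  fourier2 (boxWeight q d₁ d₂ (l / d₁) (m / d₂) (r + 1) i)
                      (h.1 / (q * (r + 1) : ℕ)) (h.2 / (q * (r + 1) : ℕ)) *
                    (dualCount (q * (r + 1)) ((l / d₁ : ℕ) : ZMod (q * (r + 1))) ((m / d₂ : ℕ) : ZMod (q * (r + 1)))
                      (h.1 : ZMod (q * (r + 1))) (h.2 : ZMod (q * (r + 1))) : ℂ)).re := by
  unfold offDiagNearHead
  rw [dif_neg (NeZero.ne q)]
  refine neg_re_mul_congr (Finset.sum_congr rfl fun r _ ↦ Finset.sum_congr rfl fun l hl ↦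
    Finset.sum_congr rfl fun m hm ↦ ?_)
  have hl1 : 1 ≤ l := (Finset.mem_Icc.mp hl).1
  have hm1 : 1 ≤ m := (Finset.mem_Icc.mp hm).1
  rw [Finset.sum_congr rfl fun d₁ hd₁ ↦ Finset.sum_congr rfl fun d₂ hd₂ ↦ Finset.sum_congr rfl fun i _ ↦
    tsum_box_eq_tsum_dual (q := q) (r := r + 1) (Nat.pos_of_mem_divisors hd₁) (Nat.pos_of_mem_divisors hd₂)
      (OffDiagDual.one_le_div_of_dvd (Nat.dvd_of_mem_divisors hd₁) hl1)
      (OffDiagDual.one_le_div_of_dvd (Nat.dvd_of_mem_divisors hd₂) hm1) (Nat.succ_ne_zero r) i]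

end Summit.Parity.GeneralizedHardyLittlewood.Theorems.BeyondDiagonalBeatsQuarter.OffDiag
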